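import Literature.Algebra.Lie.LefschetzAlgebra
import Literature.AlgebraicGeometry.Motives.HodgeStructureExteriorPowerLefschetzDual
import HarnessLib

/-!
# The exterior algebra of a symplectic space as a Lefschetz module (Looijenga–Lunts §1 (1.1)/(1.4), §3 (3.3)):
# `e_ω = ω ∧ ·` has the Lefschetz property for `h = l - g` on `⋀ˡ W`, and its `𝔰𝔩₂`-partner `f_ω` IS `Λ_ω`

[topic AlgebraicGeometry/Motives]

Layer `Literature/AlgebraicGeometry/Motives`, lane `lit-hodgefound` (Track 2 foundations library; prover seat `lit-hodgefound-p34`,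
generation 29, row g29-#1). THEOREMS ONLY (no `def`, no named fact, no instance, no notation; net debt `0`). This file is the
BRIDGE between the two Lefschetz kits of the tree:

* the abstract symplectic exterior-algebra kit of `Motives/HodgeStructureExteriorPowerLefschetz` / `…LefschetzDual` (Q351/Q454:
  `IsSymplectic ω g`, `lefschetzPow`, `primitive`, the counting operator `deg b`, `lefschetzDual ω g = Λ_ω`), and
* the abstract Lefschetz-MODULE layer of `Algebra/Lie/LefschetzModule` + `Algebra/Lie/LefschetzAlgebra` (rows A1-88 / A1-119 of
  seat `lit-hodgefound-skel-1`: `degreeSpace`, `IsZGrading`, `HasLefschetzProperty`, `primitiveSpace`, the constructed partner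
  `HasLefschetzProperty.dual`, `depth`, `shiftedDegree`, `IsGradedCommutative`, `mulLeftDegTwo`).

It is the abstract-carrier twin of `Geometry/Kaehler/ComplexTorusLefschetzModule` (A1-89, torus-forms carrier `GForm E ℂ`) and of
`AlgebraicGeometry/Hyperkaehler/TotalCohomologyLefschetzModule` (singular-cohomology carrier); nothing of those files is restated or
imported (RULING 29: different carriers, announced by name).

## Source, VERBATIM

E. Looijenga, V. A. Lunts, *A Lie algebra attached to a projective variety*, Invent. Math. **129** (1997) 361–412 [LooijengaLunts1997]
(held TeX text `paper:arxiv-alg-geom_9604014`):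

* §3 (3.3), p0013 L83–L97: "Now let `X` be a real torus of even dimension `2n`. We identify the universal cover of `X` with `H_1(X;ℝ)`.
  We will write `V` for this real vector space (of dimension `2n`) so that `H(X;ℝ) = ∧•V^*`. […] Let `κ ∈ ∧²V^*` be nondegenerate.
  If `α_{±1}, …, α_{±n}` is a basis of `V^*` such that `κ = Σ_{k=1}^n α_k ∧ α_{-k}` then `e_κ = Σ_{k=1}^n e_{α_k} e_{α_{-k}}`. If
  `a_{±1}, …, a_{±n}` is the dual basis, then we see from eq. ** that `[e_κ, Σ_{k=1}^n i_{a_{-k}} i_{a_k}] = -n + Σ_{k=1}^n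
  (e_{α_k} i_{a_k} + e_{α_{-k}} i_{a_{-k}})`. Since this element acts on `∧^l V^*` as multiplication by `-n + l`, it follows that
  `f_κ` is defined and equal to `Σ_{k=1}^n i_{a_{-k}} i_{a_k}`."
* §1 (1.1), p0003 L106–p0004 L5: "denote by `h : M → M` the transformation that is multiplication by `k` in degree `k`. […] We say
  that a linear transformation `e : M → M` of degree `2` has the Lefschetz property if for all integers `k ≥ 0`, `e^k` maps `M_{-k}`
  isomorphically onto `M_k`. According to the Jacobson–Morozov lemma this is equivalent to the existence of `K`-linear transformation
  `f` in `M` of degree `-2` such that `[e, f] = h`. This `f` is then unique and `(e, h, f)` is a `𝔰𝔩(2)`-triple"; p0004 L56–L60: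
  "we call greatest integer `n` with `M_n ≠ 0` (or equivalently, `M_{-n} ≠ 0`) the depth of `M`."
* §1 (1.4), p0005 L17–L20: "Many Lefschetz modules have the additional structure of an algebra. Let `A = ⊕_{i=0}^{2n} A_i` be a
  graded-commutative algebra with `A_0 = K`. We say that `A` is a Lefschetz algebra of depth `n` if `A[n]` is a Lefschetz module of
  depth `n` over `A_2`."

C. Voisin, *Hodge Theory and Complex Algebraic Geometry I* [Voisin2002], §6.2.1 Lemma 6.19 (`[L, Λ] = (k - n) Id` on `k`-forms),
Lemma 6.20 (`L^{n-k}` injective, hence bijective); D. Huybrechts, *Complex Geometry* [Huybrechts2005], Prop. 1.2.26 / 1.2.30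
(the `𝔰𝔩₂`-triple `(L, H = Σ (k - n) Πᵏ, Λ)` of the exterior algebra and the uniqueness of `Λ`).

## Reading (dictionary), and what is PROVED

`K` a field of characteristic `0`, `W` a `K`-space, `A = ExteriorAlgebra K W` graded by Mathlib's `fun i ↦ ⋀[K]^i W`
(`ExteriorAlgebra.gradedAlgebra`), `ω : ExteriorAlgebra K W` with `IsSymplectic ω g` (a Darboux basis `b` of genus `g`, `dim W = 2g`,
`ω = Σ eᵢ ∧ fᵢ` — L–L's "`κ` nondegenerate"). L–L's `h` ("multiplication by `-n + l` on `∧ˡ`") is A1-119's `shiftedDegree K _ g`,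
their `e_κ` is `LinearMap.mul K A ω` (= Q351's `lef b`), their `Σ i_{a_{-k}} i_{a_k}` is Q351's `lam b` = Q454's `lefschetzDual ω g`.

* §1 `deg_sub_smul_one_eq_shiftedDegree` (Q351's basis counting operator `N_b - g` IS `shiftedDegree K _ g`, for ANY finite basis),
  `shiftedDegree_apply_of_mem_exteriorPower`, `degreeSpace_shiftedDegree_eq_exteriorPower` (`M_m = ⋀^{m+g} W`),
  `degreeSpace_shiftedDegree_eq_bot_of_lt` (`M_m = 0` for `m < -g`), `mul_pow_apply` (`e_ω^j x = ω^j ∧ x`).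
* §2 **`IsSymplectic.hasLefschetzProperty_mul` — "`f_κ` is defined": `e_ω` has the Lefschetz property on `(⋀ W, h)`** (Q351's hard
  Lefschetz `lefschetzPow_bijective`: `ω^k ∧ · : ⋀^{g-k} ≅ ⋀^{g+k}`); `shiftedDegree_ne_zero` (`h ≠ 0` for `g ≥ 1`).
* §3 **`IsSymplectic.isSl2Triple_shiftedDegree_mul_lefschetzDual`** (Mathlib `IsSl2Triple h e_ω Λ_ω`, basis-free, `g ≥ 1`),
  **`IsSymplectic.dual_eq_lefschetzDual` — "and equal to `Σ i_{a_{-k}} i_{a_k}`": A1-88's CONSTRUCTED partner `f` of `e_ω` is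
  `Λ_ω`**, and `IsSymplectic.eq_lefschetzDual_of_isSl2Triple` ("This `f` is then unique", basis-free on `⋀ W`);
  `IsSymplectic.lefschetzDual_mem_lefschetzDuals` / `…_mem_lefschetzLieAlgebra` (`Λ_ω ∈ 𝔤(𝔞, ⋀ W)` for any `𝔞 ∋ e_ω`).
* §4 `primitiveSpace_shiftedDegree_mul_eq_primitive` (A1-88's `P_{-k} = M_{-k} ∩ ker e^{k+1}` IS Q351's `P^{g-k} = ⋀^{g-k} ∩ ker L^{k+1}`,
  `k ≤ g`), `primitive_eq_primitiveSpace`, `primitiveSpace_shiftedDegree_mul_eq_bot` (`k > g`).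
* §5 **`IsSymplectic.depth_shiftedDegree_eq` — the depth of `(⋀ W, h)` is `g`** (`M_g = ⋀^{2g} ∋ ω^g ≠ 0`, `M_n = ⋀^{g+n} = 0` for `n > g`).
* §6 (1.4) for `A = ⋀ W`: `isGradedCommutative_exteriorPower` ("graded-commutative", Q454's `mul_comm_of_mem`),
  `exists_algebraMap_eq_of_mem_exteriorPower_zero` ("`A_0 = K`"), `IsSymplectic.exteriorPower_eq_bot_of_lt` ("`A = ⊕_{i ≤ 2n} A_i`"),
  `IsSymplectic.mul_mem_lefschetzDomain` (`e_ω` is a Lefschetz element of `𝔞 = A_2`: the domain of `f` on `mulLeftDegTwo` is non-empty).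

## SCOPE (not formalised here)

"`A[n]` is a Lefschetz module over `A_2`", i.e. A1-119's `IsLefschetzAlgebra K (fun i ↦ ⋀[K]^i W) g`, requires the SEMISIMPLICITY of
`𝔤(⋀² W, ⋀ W[g])`, which by L–L (3.3) Proposition is `𝔰𝔬(V^* ⊕ V)` (type `D_{2g}`) acting on the spinor module `⋀ W` — not in the tree on
this carrier (on the torus-forms carrier it is A1-57/A1-89's `isSemisimple_totalLieAlgebra'`); only the remaining clauses of (1.4) are
recorded (§6). The converse "Lefschetz property of `e_ω` ⟹ `ω` non-degenerate" (A1-89's `hasLefschetzProperty_lefschetzG_iff`) is not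
restated here.

## References

* [LooijengaLunts1997] E. Looijenga, V. A. Lunts, *A Lie algebra attached to a projective variety*, Invent. Math. 129 (1997) 361–412,
  §1 (1.1) p. 3–4, (1.4) p. 5, §3 (3.3) p. 13 (held TeX text `paper:arxiv-alg-geom_9604014`).
* [Voisin2002] C. Voisin, *Hodge Theory and Complex Algebraic Geometry I* (CUP 2002), §6.2.1 Lemma 6.19, Lemma 6.20, Cor. 6.25.
* [Huybrechts2005] D. Huybrechts, *Complex Geometry. An Introduction* (Springer 2005), Prop. 1.2.26, Prop. 1.2.30.
* [BourbakiAlgebre1a3] N. Bourbaki, *Algèbre*, Ch. III §7 (exterior algebra: grading, graded commutativity, `⋀⁰ = K`, `⋀ᵖ = 0` for `p > dim`).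
-/

namespace Literature.AlgebraicGeometry.Motives.ExteriorLefschetz

open Literature.Algebra.Lie ExteriorAlgebra Module Function Set
open Literature.Algebra.Lie.HasLefschetzProperty (primitiveSpace mem_primitiveSpace_iff)

-- The commutator Lie ring of `𝔤𝔩(⋀ W) = Module.End K (ExteriorAlgebra K W)`: Mathlib's reducible NON-instance, enabled file-locally
-- exactly as in `Algebra/Lie/LefschetzModule.lean` and `Motives/HodgeStructureExteriorPowerLefschetz.lean` (§2 `isSl2Triple`).
attribute [local instance 100] LieRing.ofAssociativeRing

universe u v

/-! ## §1 The degree operator `h` of `⋀ W[g]`: `h = l - g` on `⋀ˡ W` -/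

section Degree

variable {K : Type u} [Field K] {W : Type v} [AddCommGroup W] [Module K W]

/-- `h x = (k - g) x` for `x ∈ ⋀ᵏ W` ("this element acts on `∧ˡ V^*` as multiplication by `-n + l`").
[cite: LooijengaLunts1997, §3 (3.3) p. 13 L94–L95] [cite: Voisin2002, §6.2.1 Lemma 6.19] -/
theorem shiftedDegree_apply_of_mem_exteriorPower (g : ℕ) {k : ℕ} {x : ExteriorAlgebra K W} (hx : x ∈ ⋀[K]^k W) :
    shiftedDegree K (fun i : ℕ ↦ ⋀[K]^i W) g x = ((k : K) - g) • x := by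
  rw [shiftedDegree_apply_of_mem K (fun i : ℕ ↦ ⋀[K]^i W) g hx]
  push_cast
  rfl

/-- **The counting operator of Q351 IS the degree operator of A1-119: `N_b - g · 1 = h`** for every finite basis `b` of `W`
(Huybrechts' `H = Σ (k - n) Πᵏ`; both act by `k - g` on `⋀ᵏ W` and `⋀ W = ⊕ₖ ⋀ᵏ W`).
[cite: Huybrechts2005, Prop. 1.2.26] [cite: LooijengaLunts1997, §3 (3.3) p. 13 L91–L95] -/
theorem deg_sub_smul_one_eq_shiftedDegree {I : Type*} [Fintype I] (b : Module.Basis I K W) (g : ℕ) :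
    deg b - (g : K) • (1 : Module.End K (ExteriorAlgebra K W)) = shiftedDegree K (fun i : ℕ ↦ ⋀[K]^i W) g := by
  refine LinearMap.ext fun x ↦ ?_
  induction x using DirectSum.Decomposition.inductionOn (fun i : ℕ ↦ ⋀[K]^i W) with
  | zero => rw [map_zero, map_zero]
  | homogeneous x =>
    rw [shiftedDegree_apply_of_mem_exteriorPower g x.2, LinearMap.sub_apply, deg_apply_of_mem b x.2, LinearMap.smul_apply,
      Module.End.one_apply, sub_smul]
  | add x y hx hy => rw [map_add, map_add, hx, hy]

variable [CharZero K]

/-- **`M_m = ⋀^{m+g} W`**: the degree-`m` part of `(⋀ W, h)` is the exterior power of degree `m + g` (when `m + g ≥ 0`).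
[cite: LooijengaLunts1997, §3 (3.3) p. 13 L94–L95] [cite: LooijengaLunts1997, §1 (1.4) p. 5 L19–L20 ("A[n]")] -/
theorem degreeSpace_shiftedDegree_eq_exteriorPower (g : ℕ) (m : ℤ) (k : ℕ) (hmk : m + g = k) :
    degreeSpace (shiftedDegree K (fun i : ℕ ↦ ⋀[K]^i W) g) m = ⋀[K]^k W := by
  rw [show m = (k : ℤ) - g by omega]
  exact degreeSpace_shiftedDegree_eq K (fun i : ℕ ↦ ⋀[K]^i W) g k

/-- Membership form: `x ∈ M_{k-g} ↔ x ∈ ⋀ᵏ W`. [cite: LooijengaLunts1997, §3 (3.3) p. 13 L94–L95] -/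
theorem mem_degreeSpace_shiftedDegree_iff (g : ℕ) {k : ℕ} {x : ExteriorAlgebra K W} :
    x ∈ degreeSpace (shiftedDegree K (fun i : ℕ ↦ ⋀[K]^i W) g) ((k : ℤ) - g) ↔ x ∈ ⋀[K]^k W := by
  rw [degreeSpace_shiftedDegree_eq_exteriorPower g ((k : ℤ) - g) k (by omega)]

/-- **`M_m = 0` for `m < -g`** (no exterior powers of negative degree). [cite: LooijengaLunts1997, §1 (1.1) p. 4 L58–L60] -/
theorem degreeSpace_shiftedDegree_eq_bot_of_lt (g : ℕ) {m : ℤ} (hm : m + g < 0) :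
    degreeSpace (shiftedDegree K (fun i : ℕ ↦ ⋀[K]^i W) g) m = ⊥ :=
  degreeSpace_shiftedDegree_eq_bot K (fun i : ℕ ↦ ⋀[K]^i W) g fun i ↦ by omega

omit [CharZero K] in
/-- `e_ω^j x = ω^j ∧ x`: the powers of the multiplication operator `e_ω = ω ∧ ·`. [folklore] -/
private theorem mul_pow_apply (ω : ExteriorAlgebra K W) (j : ℕ) (x : ExteriorAlgebra K W) :
    (LinearMap.mul K (ExteriorAlgebra K W) ω ^ j) x = ω ^ j * x := by
  induction j with
  | zero => rw [pow_zero, pow_zero, one_mul, Module.End.one_apply]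
  | succ j ih => rw [pow_succ', Module.End.mul_apply, ih, LinearMap.mul_apply', ← mul_assoc, ← pow_succ']

omit [CharZero K] in
/-- The powers of `e_ω` in the exterior algebra: `e_ω^j = ω^j ∧ ·` ("`e_κ`", the operator of L–L §3).
[cite: LooijengaLunts1997, §3 (3.3) p. 13 L88–L90] -/
theorem mul_pow_eq_mul_pow (ω : ExteriorAlgebra K W) (j : ℕ) :
    LinearMap.mul K (ExteriorAlgebra K W) ω ^ j = LinearMap.mul K (ExteriorAlgebra K W) (ω ^ j) :=
  LinearMap.ext fun x ↦ by rw [mul_pow_apply, LinearMap.mul_apply']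

end Degree

/-! ## §2 "`f_κ` is defined": `e_ω = ω ∧ ·` has the Lefschetz property on `(⋀ W, h)` -/

section LefschetzProperty

variable {K : Type u} [Field K] [CharZero K] {W : Type v} [AddCommGroup W] [Module K W]
variable {ω : ExteriorAlgebra K W} {g : ℕ}

/-- **Looijenga–Lunts §3: for a non-degenerate 2-vector `ω` (Darboux form `Σ eᵢ ∧ fᵢ`, genus `g`), `e_ω = ω ∧ ·` has the
Lefschetz property on `(⋀ W, h)`, `h = l - g` on `⋀ˡ W`** ("it follows that `f_κ` is defined"): `e_ω (M_k) ⊆ M_{k+2}` and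
`e_ω^k : M_{-k} = ⋀^{g-k} W → M_k = ⋀^{g+k} W` is bijective for every `k ≥ 0` — Q351's hard Lefschetz
`IsSymplectic.lefschetzPow_bijective` for `k ≤ g`, and `M_{±k} = 0` for `k > g`.
[cite: LooijengaLunts1997, §3 (3.3) p. 13 L88–L97] [cite: LooijengaLunts1997, §1 (1.1) p. 4 L1–L2] [cite: Voisin2002, §6.2.1 Lemma 6.20, Cor. 6.25] -/
theorem IsSymplectic.hasLefschetzProperty_mul (hω : IsSymplectic ω g) :
    HasLefschetzProperty (shiftedDegree K (fun i : ℕ ↦ ⋀[K]^i W) g) (LinearMap.mul K (ExteriorAlgebra K W) ω) where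
  mapsTo k := by
    intro x hx
    by_cases hk : 0 ≤ k + g
    · obtain ⟨n, hn⟩ : ∃ n : ℕ, k + g = n := ⟨(k + g).toNat, (Int.toNat_of_nonneg hk).symm⟩
      rw [SetLike.mem_coe, degreeSpace_shiftedDegree_eq_exteriorPower g k n hn] at hx
      rw [SetLike.mem_coe, degreeSpace_shiftedDegree_eq_exteriorPower g (k + 2) (n + 2) (by omega), LinearMap.mul_apply']
      have h1 := pow_mul_mem_exteriorPower hω.mem 1 hx
      rwa [pow_one, show 2 * 1 + n = n + 2 by omega] at h1
    · rw [SetLike.mem_coe, degreeSpace_shiftedDegree_eq_bot_of_lt g (by omega), Submodule.mem_bot] at hx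
      rw [hx, map_zero]
      exact Submodule.zero_mem _
  bijOn k := by
    by_cases hk : k ≤ g
    · rw [degreeSpace_shiftedDegree_eq_exteriorPower g (-(k : ℤ)) (g - k) (by omega),
        degreeSpace_shiftedDegree_eq_exteriorPower g (k : ℤ) (g + k) (by omega)]
      have hb := hω.lefschetzPow_bijective (k := g - k) (j := k) (m := g + k) (by omega) (by omega)
      have happ : ∀ x : ⋀[K]^(g - k) W, (LinearMap.mul K (ExteriorAlgebra K W) ω ^ k) (x : ExteriorAlgebra K W) =
          ((lefschetzPow ω hω.mem k (show 2 * k + (g - k) = g + k by omega) x : ⋀[K]^(g + k) W) : ExteriorAlgebra K W) :=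
        fun x ↦ by rw [mul_pow_apply, lefschetzPow_apply_coe]
      refine ⟨fun x hx ↦ ?_, fun x hx y hy hxy ↦ ?_, fun y hy ↦ ?_⟩
      · rw [SetLike.mem_coe] at hx ⊢
        rw [happ ⟨x, hx⟩]
        exact Submodule.coe_mem _
      · have h1 : lefschetzPow ω hω.mem k (show 2 * k + (g - k) = g + k by omega) ⟨x, hx⟩ =
            lefschetzPow ω hω.mem k (show 2 * k + (g - k) = g + k by omega) ⟨y, hy⟩ :=
          Subtype.ext (by rw [← happ ⟨x, hx⟩, ← happ ⟨y, hy⟩]; exact hxy)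
        exact congrArg Subtype.val (hb.1 h1)
      · obtain ⟨x, hx⟩ := hb.2 ⟨y, hy⟩
        exact ⟨x, x.2, by rw [happ x, hx]⟩
    · rw [degreeSpace_shiftedDegree_eq_bot_of_lt g (by omega),
        degreeSpace_shiftedDegree_eq_exteriorPower g (k : ℤ) (g + k) (by omega), hω.exteriorPower_eq_bot (by omega),
        Submodule.bot_coe]
      exact Set.bijOn_singleton.2 (map_zero _)

/-- **`h ≠ 0` for `g ≥ 1`** (`h 1 = -g · 1`; Mathlib's `IsSl2Triple` and A1-88's depth statements want `M ≠ M₀`).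
[cite: LooijengaLunts1997, §1 (1.1) p. 3 L106–L108] [cite: Huybrechts2005, Prop. 1.2.26] -/
theorem shiftedDegree_ne_zero (hg : 0 < g) : shiftedDegree K (fun i : ℕ ↦ ⋀[K]^i W) g ≠ 0 := by
  intro h
  have h1 := LinearMap.congr_fun h (1 : ExteriorAlgebra K W)
  have h0 : (1 : ExteriorAlgebra K W) ∈ ⋀[K]^0 W := by
    rw [ExteriorAlgebra.exteriorPower, pow_zero]; exact Submodule.one_le.mp le_rfl
  rw [shiftedDegree_apply_of_mem_exteriorPower g h0, LinearMap.zero_apply, Nat.cast_zero, zero_sub, smul_eq_zero,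
    neg_eq_zero, Nat.cast_eq_zero] at h1
  rcases h1 with h1 | h1
  · omega
  · exact one_ne_zero h1

end LefschetzProperty

/-! ## §3 "… and equal to `Σ i_{a_{-k}} i_{a_k}`": the `𝔰𝔩₂`-partner of `e_ω` IS `Λ_ω` -/

section Partner

variable {K : Type u} [Field K] [CharZero K] {W : Type v} [AddCommGroup W] [Module K W]
variable {ω : ExteriorAlgebra K W} {g : ℕ}

/-- **The Lefschetz `𝔰𝔩₂`-triple `(h, e_ω, Λ_ω)` of a symplectic 2-vector, BASIS-FREE** (Mathlib `IsSl2Triple` for the commutator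
bracket of `End(⋀ W)`; `g ≥ 1`): L–L's "`[e_κ, Σ i_{a_{-k}} i_{a_k}] = -n + Σ (e_{α_k} i_{a_k} + e_{α_{-k}} i_{a_{-k}})`" together with
"`e_κ`, `f_κ` of degrees `±2`" — Q351's `isSl2Triple b` read through `deg_sub_smul_one_eq_shiftedDegree` and Q454's
`lam_eq_lefschetzDual`. [cite: LooijengaLunts1997, §3 (3.3) p. 13 L88–L97] [cite: Huybrechts2005, Prop. 1.2.26] -/
theorem IsSymplectic.isSl2Triple_shiftedDegree_mul_lefschetzDual (hω : IsSymplectic ω g) (hg : 0 < g) :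
    IsSl2Triple (shiftedDegree K (fun i : ℕ ↦ ⋀[K]^i W) g) (LinearMap.mul K (ExteriorAlgebra K W) ω) (lefschetzDual ω g) := by
  obtain ⟨b, rfl⟩ := hω
  have h2 : LinearMap.mul K (ExteriorAlgebra K W) (twoVector b) = lef b := LinearMap.ext fun x ↦ rfl
  rw [← deg_sub_smul_one_eq_shiftedDegree b g, h2, ← lam_eq_lefschetzDual b]
  exact isSl2Triple b hg

/-- **"This `f` is then unique": any `𝔰𝔩₂`-partner of `e_ω` on `(⋀ W, h)` is `Λ_ω`** (basis-free uniqueness of the dual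
Lefschetz operator of the exterior algebra; Huybrechts Prop. 1.2.30: "`Λ` is uniquely determined").
[cite: LooijengaLunts1997, §1 (1.1) p. 4 L4] [cite: Huybrechts2005, Prop. 1.2.30] -/
theorem IsSymplectic.eq_lefschetzDual_of_isSl2Triple (hω : IsSymplectic ω g) (hg : 0 < g) {f : Module.End K (ExteriorAlgebra K W)}
    (t : IsSl2Triple (shiftedDegree K (fun i : ℕ ↦ ⋀[K]^i W) g) (LinearMap.mul K (ExteriorAlgebra K W) ω) f) :
    f = lefschetzDual ω g := by
  haveI := hω.finite
  haveI : FiniteDimensional K (ExteriorAlgebra K W) := Module.Finite.of_basis (Module.finBasis K W).ExteriorAlgebra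
  rw [hω.hasLefschetzProperty_mul.eq_dual_of_isSl2Triple (isZGrading_shiftedDegree K (fun i : ℕ ↦ ⋀[K]^i W) g) t]
  exact (hω.hasLefschetzProperty_mul.eq_dual_of_isSl2Triple (isZGrading_shiftedDegree K (fun i : ℕ ↦ ⋀[K]^i W) g)
    (hω.isSl2Triple_shiftedDegree_mul_lefschetzDual hg)).symm

/-- **Looijenga–Lunts' `f_κ` IS `Λ`: the partner of `e_ω` CONSTRUCTED in A1-88 (`HasLefschetzProperty.dual`, the graded
Jacobson–Morozov lemma) equals Q454's `lefschetzDual ω g = Σᵢ i(fᵢ*) i(eᵢ*)`** ("it follows that `f_κ` is defined and equal to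
`Σ_{k=1}^n i_{a_{-k}} i_{a_k}`"; `g ≥ 1`). [cite: LooijengaLunts1997, §3 (3.3) p. 13 L94–L97] [cite: LooijengaLunts1997, §1 (1.1) p. 4 L2–L5] -/
theorem IsSymplectic.dual_eq_lefschetzDual (hω : IsSymplectic ω g) (hg : 0 < g) :
    hω.hasLefschetzProperty_mul.dual (isZGrading_shiftedDegree K (fun i : ℕ ↦ ⋀[K]^i W) g) = lefschetzDual ω g := by
  haveI := hω.finite
  haveI : FiniteDimensional K (ExteriorAlgebra K W) := Module.Finite.of_basis (Module.finBasis K W).ExteriorAlgebra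
  exact (hω.hasLefschetzProperty_mul.eq_dual_of_isSl2Triple (isZGrading_shiftedDegree K (fun i : ℕ ↦ ⋀[K]^i W) g)
    (hω.isSl2Triple_shiftedDegree_mul_lefschetzDual hg)).symm

/-- `Λ_ω` is a Lefschetz dual of `𝔞` ("the image of `f`") for every subspace `𝔞 ⊆ 𝔤𝔩(⋀ W)` containing `e_ω`.
[cite: LooijengaLunts1997, §1 (1.1) p. 4 L28–L37] -/
theorem IsSymplectic.lefschetzDual_mem_lefschetzDuals (hω : IsSymplectic ω g) (hg : 0 < g)
    {𝔞 : Submodule K (Module.End K (ExteriorAlgebra K W))} (hω𝔞 : LinearMap.mul K (ExteriorAlgebra K W) ω ∈ 𝔞) :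
    lefschetzDual ω g ∈ lefschetzDuals K (shiftedDegree K (fun i : ℕ ↦ ⋀[K]^i W) g) 𝔞 :=
  ⟨_, hω𝔞, hω.isSl2Triple_shiftedDegree_mul_lefschetzDual hg⟩

/-- Hence `Λ_ω ∈ 𝔤(𝔞, ⋀ W)` and `h ∈ 𝔤(𝔞, ⋀ W)` for every `𝔞 ∋ e_ω` ("the Lie subalgebra of `𝔤𝔩(M)` generated by the
transformations `e_a, f_a`"). [cite: LooijengaLunts1997, §1 (1.1) p. 4 L35–L37] -/
theorem IsSymplectic.lefschetzDual_mem_lefschetzLieAlgebra (hω : IsSymplectic ω g) (hg : 0 < g)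
    {𝔞 : Submodule K (Module.End K (ExteriorAlgebra K W))} (hω𝔞 : LinearMap.mul K (ExteriorAlgebra K W) ω ∈ 𝔞) :
    lefschetzDual ω g ∈ lefschetzLieAlgebra K (shiftedDegree K (fun i : ℕ ↦ ⋀[K]^i W) g) 𝔞 ∧
      shiftedDegree K (fun i : ℕ ↦ ⋀[K]^i W) g ∈ lefschetzLieAlgebra K (shiftedDegree K (fun i : ℕ ↦ ⋀[K]^i W) g) 𝔞 :=
  ⟨lefschetzDuals_subset_lefschetzLieAlgebra (hω.lefschetzDual_mem_lefschetzDuals hg hω𝔞),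
    h_mem_lefschetzLieAlgebra_of_isSl2Triple hω𝔞 (hω.isSl2Triple_shiftedDegree_mul_lefschetzDual hg)⟩

end Partner

/-! ## §4 The primitive spaces: `P_{-k}` of A1-88 is `P^{g-k}` of Q351 -/

section Primitive

variable {K : Type u} [Field K] [CharZero K] {W : Type v} [AddCommGroup W] [Module K W]

/-- **`P_{-k} = M_{-k} ∩ ker e_ω^{k+1}` IS `P^{g-k} = ⋀^{g-k} W ∩ ker(ω^{k+1} ∧ ·)`** (`k ≤ g`; Cattani's (A.3.5) / L–L §2 (2.2)
primitive part of the Lefschetz module versus Voisin's Def. 6.21 / Lange's §7.3.2 primitive `k`-vectors).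
[cite: LooijengaLunts1997, §2 (2.2)] [cite: Voisin2002, §6.2.2 Def. 6.21, Cor. 6.25] -/
theorem primitiveSpace_shiftedDegree_mul_eq_primitive (ω : ExteriorAlgebra K W) (g : ℕ) {k : ℕ} (hk : k ≤ g) :
    primitiveSpace (shiftedDegree K (fun i : ℕ ↦ ⋀[K]^i W) g) (LinearMap.mul K (ExteriorAlgebra K W) ω) k =
      primitive ω g (g - k) := by
  ext x
  rw [mem_primitiveSpace_iff, mem_primitive_iff, degreeSpace_shiftedDegree_eq_exteriorPower g (-(k : ℤ)) (g - k) (by omega),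
    mul_pow_eq_mul_pow, LinearMap.mul_apply', show g - (g - k) + 1 = k + 1 by omega]

/-- The same dictionary read from the exterior-algebra side: `Pᵏ = P_{-(g-k)}` for `k ≤ g`.
[cite: LooijengaLunts1997, §2 (2.2)] [cite: Voisin2002, §6.2.2 Def. 6.21] -/
theorem primitive_eq_primitiveSpace (ω : ExteriorAlgebra K W) (g : ℕ) {k : ℕ} (hk : k ≤ g) :
    primitive ω g k = primitiveSpace (shiftedDegree K (fun i : ℕ ↦ ⋀[K]^i W) g) (LinearMap.mul K (ExteriorAlgebra K W) ω) (g - k) := by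
  rw [primitiveSpace_shiftedDegree_mul_eq_primitive ω g (by omega : g - k ≤ g), show g - (g - k) = k by omega]

/-- Beyond the depth there are no primitive vectors: `P_{-k} = 0` for `k > g` (`M_{-k} = 0`).
[cite: LooijengaLunts1997, §1 (1.1) p. 4 L58–L60] -/
theorem primitiveSpace_shiftedDegree_mul_eq_bot (ω : ExteriorAlgebra K W) (g : ℕ) {k : ℕ} (hk : g < k) :
    primitiveSpace (shiftedDegree K (fun i : ℕ ↦ ⋀[K]^i W) g) (LinearMap.mul K (ExteriorAlgebra K W) ω) k = ⊥ := by
  rw [primitiveSpace, degreeSpace_shiftedDegree_eq_bot_of_lt g (by omega), bot_inf_eq]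

end Primitive

/-! ## §5 The depth of `(⋀ W, h)` is `g` -/

section Depth

variable {K : Type u} [Field K] [CharZero K] {W : Type v} [AddCommGroup W] [Module K W]
variable {ω : ExteriorAlgebra K W} {g : ℕ}

/-- `M_g = ⋀^{2g} W ≠ 0` (it contains `ω^g ≠ 0`). [cite: LooijengaLunts1997, §1 (1.1) p. 4 L58–L60] [cite: Voisin2002, §6.2.1 Lemma 6.20] -/
theorem IsSymplectic.degreeSpace_shiftedDegree_self_ne_bot (hω : IsSymplectic ω g) :
    degreeSpace (shiftedDegree K (fun i : ℕ ↦ ⋀[K]^i W) g) (g : ℤ) ≠ ⊥ := by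
  rw [degreeSpace_shiftedDegree_eq_exteriorPower g (g : ℤ) (2 * g) (by omega), Submodule.ne_bot_iff]
  exact ⟨ω ^ g, by simpa using pow_mem_exteriorPower hω.mem g, hω.pow_ne_zero⟩

/-- `M_n = ⋀^{g+n} W = 0` for `n > g`. [cite: LooijengaLunts1997, §1 (1.1) p. 4 L58–L60] [cite: BourbakiAlgebre1a3, Ch. III §7 no. 3 Prop. 6] -/
theorem IsSymplectic.degreeSpace_shiftedDegree_eq_bot_of_gt (hω : IsSymplectic ω g) {n : ℕ} (hn : g < n) :
    degreeSpace (shiftedDegree K (fun i : ℕ ↦ ⋀[K]^i W) g) (n : ℤ) = ⊥ := by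
  rw [degreeSpace_shiftedDegree_eq_exteriorPower g (n : ℤ) (g + n) (by omega)]
  exact hω.exteriorPower_eq_bot (by omega)

/-- **The depth of the Lefschetz module `(⋀ W, h)` of a symplectic space of dimension `2g` is `g`** ("we call greatest integer
`n` with `M_n ≠ 0` […] the depth of `M`"; here `M_{±g} = ⋀^{2g} W, ⋀⁰ W ≠ 0` and `M_n = 0` for `|n| > g`).
[cite: LooijengaLunts1997, §1 (1.1) p. 4 L58–L60] [cite: LooijengaLunts1997, §1 (1.4) p. 5 L19–L20 ("of depth n")] -/
theorem IsSymplectic.depth_shiftedDegree_eq (hω : IsSymplectic ω g) :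
    depth (shiftedDegree K (fun i : ℕ ↦ ⋀[K]^i W) g) = g := by
  haveI := hω.finite
  haveI : FiniteDimensional K (ExteriorAlgebra K W) := Module.Finite.of_basis (Module.finBasis K W).ExteriorAlgebra
  refine le_antisymm ?_ (hω.hasLefschetzProperty_mul.le_depth hω.degreeSpace_shiftedDegree_self_ne_bot)
  refine csSup_le ⟨g, hω.degreeSpace_shiftedDegree_self_ne_bot⟩ fun n hn ↦ ?_
  by_contra hlt
  exact hn (hω.degreeSpace_shiftedDegree_eq_bot_of_gt (not_le.1 hlt))

end Depth

/-! ## §6 The clauses of (1.4) for `A = ⋀ W`: graded-commutative, `A_0 = K`, `A_i = 0` for `i > 2g`, `e_ω ∈ A_2` Lefschetz -/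

section LefschetzAlgebraClauses

variable {K : Type u} [Field K] {W : Type v} [AddCommGroup W] [Module K W]

/-- **"a graded-commutative algebra": `⋀ W` is graded-commutative** in the sense of A1-119 (`y x = (-1)^{ij} x y` for `x ∈ ⋀ⁱ`,
`y ∈ ⋀ʲ`; Q454's `mul_comm_of_mem`). [cite: LooijengaLunts1997, §1 (1.4) p. 5 L18] [cite: BourbakiAlgebre1a3, Ch. III §7 no. 1] -/
theorem isGradedCommutative_exteriorPower : IsGradedCommutative K (fun i : ℕ ↦ ⋀[K]^i W) :=
  ⟨fun i j x y hx hy ↦ by rw [mul_comm_of_mem hy hx, mul_comm j i]⟩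

/-- **"with `A_0 = K`"**: every element of `⋀⁰ W` is a scalar. [cite: LooijengaLunts1997, §1 (1.4) p. 5 L18] [cite: BourbakiAlgebre1a3, Ch. III §7 no. 1] -/
theorem exists_algebraMap_eq_of_mem_exteriorPower_zero {x : ExteriorAlgebra K W} (hx : x ∈ ⋀[K]^0 W) :
    ∃ c : K, algebraMap K (ExteriorAlgebra K W) c = x := by
  rw [ExteriorAlgebra.exteriorPower, pow_zero, Submodule.mem_one] at hx
  exact hx

variable [CharZero K] {ω : ExteriorAlgebra K W} {g : ℕ}

omit [CharZero K] in
/-- **"`A = ⊕_{i=0}^{2n} A_i`": `⋀ⁱ W = 0` for `i > 2g = dim W`** (Q351's `IsSymplectic.exteriorPower_eq_bot`, in the shape of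
A1-119's `IsLefschetzAlgebra.eq_bot_of_lt`). [cite: LooijengaLunts1997, §1 (1.4) p. 5 L17–L18] [cite: BourbakiAlgebre1a3, Ch. III §7 no. 3 Prop. 6] -/
theorem IsSymplectic.exteriorPower_eq_bot_of_lt (hω : IsSymplectic ω g) : ∀ i : ℕ, 2 * g < i → ⋀[K]^i W = ⊥ :=
  fun _ hi ↦ hω.exteriorPower_eq_bot hi

/-- **`e_ω` is a Lefschetz element of `𝔞 = A_2` acting by multiplication**: it lies in A1-119's `mulLeftDegTwo` and in the domain
of `f` ("for some `a ∈ 𝔞`, `e_a` has that property" — the non-degenerate 2-vectors; `g ≥ 1`).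
[cite: LooijengaLunts1997, §1 (1.1) p. 4 L28–L33] [cite: LooijengaLunts1997, §3 (3.3) p. 13 L95–L97] -/
theorem IsSymplectic.mul_mem_lefschetzDomain (hω : IsSymplectic ω g) (hg : 0 < g) :
    LinearMap.mul K (ExteriorAlgebra K W) ω ∈
      lefschetzDomain K (shiftedDegree K (fun i : ℕ ↦ ⋀[K]^i W) g) (mulLeftDegTwo K (fun i : ℕ ↦ ⋀[K]^i W)) :=
  ⟨mul_mem_mulLeftDegTwo K (fun i : ℕ ↦ ⋀[K]^i W) hω.mem, _, hω.isSl2Triple_shiftedDegree_mul_lefschetzDual hg⟩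

omit [CharZero K] in
/-- `e_ω` has `ad h`-degree `2`: `[h, e_ω] = 2 e_ω` (A1-119's `lie_shiftedDegree_mul`
specialised; "homogeneous of degree two"). [cite: LooijengaLunts1997, §1 (1.1) p. 4 L28–L29] -/
theorem lie_shiftedDegree_mul_of_mem_two (hω2 : ω ∈ ⋀[K]^2 W) (g : ℕ) :
    ⁅shiftedDegree K (fun i : ℕ ↦ ⋀[K]^i W) g, LinearMap.mul K (ExteriorAlgebra K W) ω⁆ =
      2 • LinearMap.mul K (ExteriorAlgebra K W) ω :=
  lie_shiftedDegree_mul K (fun i : ℕ ↦ ⋀[K]^i W) g hω2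

end LefschetzAlgebraClauses

end Literature.AlgebraicGeometry.Motives.ExteriorLefschetz
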